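import Summits.NavierStokesRegularity.NavierStokesRegularity.Theses.AxisymmetricExtremality
import Literature.Analysis.FluidPDE.KatoLocalLerayPressure
import Literature.Analysis.FluidPDE.SereginSverakBlowupSelection
import Literature.Analysis.FluidPDE.AxisymmetricEuler
import HarnessLib

/-!
# The logarithmic axis modulus of the swirl strictly below the lifespan — crux stmt-NavierStokesRegularity-15453 (`AxisymmetricExtremality.AxisymmetricKatoGlobal`), line registered, support for stub `stub_swirlAxisModulus`

Support lemma (`--supports stmt-NavierStokesRegularity-15453`) recording the TRIVIAL half of the
registered stub `stub_swirlAxisModulus` (the load-bearing a-priori estimate of the line): if the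
Kato solution `u` lives on `[0, T')` with `T < T'` (so `T` is NOT its maximal time) and is
continuous on the open strip `(0, T') × EuclideanSpace ℝ (Fin 3)`, then on every `[t₀, T)`, `0 < t₀ < T`, the swirl
`Γ = swirl (u t) = x₀u₁ − x₁u₀ = r u_θ` has the logarithmic modulus `|Γ(t,x)| ≤ C / |log r|³` at
the axis (`r = cylRadius x ≤ δ₀ = e⁻¹`).  Proof: a Kato solution is essentially bounded on
`(a, S) × EuclideanSpace ℝ (Fin 3)` for `0 < a`, `S < T'` (Kato's smoothing bound `‖u(t)‖_∞ ≤ C/√t`,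
`IsKatoSolutionOn.exists_ae_norm_le_of_pos`), hence bounded there (continuity), and
`|Γ| ≤ 2 r ‖u‖ ≤ 2 r M ≤ 12 M / |log r|³` because `r |log r|³ ≤ 6` on `(0, 1)` (`s³/3! ≤ eˢ` at
`s = −log r`).  The content of the stub is therefore exactly the case `T = T_max(u₀)`: a modulus
of continuity of `Γ` at the axis UP TO a potential blow-up time, which is the open a-priori
estimate of the axisymmetric-with-swirl problem (Lei–Zhang 2011, Thm. 1.1 and Seregin 2020 give
Hölder continuity of `Γ` only under Type-I control; no unconditional modulus is known).
-/

noncomputable section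

open Set MeasureTheory Filter Topology Function Metric
open scoped ENNReal NNReal
open Literature.Analysis.FluidPDE

-- `<Problem> = <Summit>` duplicates a namespace component by design (lakefile sets the same option).
set_option linter.dupNamespace false

namespace Summit.NavierStokesRegularity.NavierStokesRegularity.Theorems.AxisymmetricKatoGlobal.Registered

/-- `r |log r|³ ≤ 6` for `0 < r < 1` (substitute `s = -log r ≥ 0` and use `s³/3! ≤ eˢ`). -/
theorem mul_abs_log_pow_three_le {r : ℝ} (hr : 0 < r) (hr1 : r < 1) :
    r * |Real.log r| ^ 3 ≤ 6 := by
  set s : ℝ := -Real.log r with hs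
  have hs0 : 0 ≤ s := by
    rw [hs, neg_nonneg]
    exact Real.log_nonpos hr.le hr1.le
  have habs : |Real.log r| = s := by
    rw [hs, abs_of_nonpos (Real.log_nonpos hr.le hr1.le)]
  have hr_exp : r = Real.exp (-s) := by
    rw [hs, neg_neg, Real.exp_log hr]
  have hkey : s ^ 3 / 6 ≤ Real.exp s := by
    have h := Real.pow_div_factorial_le_exp (x := s) hs0 3
    norm_num [Nat.factorial] at h
    linarith
  have hexp_pos : 0 < Real.exp (-s) := Real.exp_pos _
  rw [habs, hr_exp]
  calc Real.exp (-s) * s ^ 3 = Real.exp (-s) * (s ^ 3 / 6) * 6 := by ring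
    _ ≤ Real.exp (-s) * Real.exp s * 6 := by gcongr
    _ = 6 := by rw [← Real.exp_add, neg_add_cancel, Real.exp_zero, one_mul]

/-- `|Γ(x)| ≤ 2 r ‖u x‖`: the swirl `x₀u₁ − x₁u₀` is bounded by twice the cylindrical radius
times the speed. -/
theorem abs_swirl_le_two_mul_cylRadius_mul_norm (u : EuclideanSpace ℝ (Fin 3) → EuclideanSpace ℝ (Fin 3)) (x : EuclideanSpace ℝ (Fin 3)) :
    |swirl u x| ≤ 2 * cylRadius x * ‖u x‖ := by
  have h0 : |x 0| ≤ cylRadius x := by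
    rw [cylRadius, ← Real.sqrt_sq_eq_abs]
    exact Real.sqrt_le_sqrt (by nlinarith [sq_nonneg (x 1)])
  have h1 : |x 1| ≤ cylRadius x := by
    rw [cylRadius, ← Real.sqrt_sq_eq_abs]
    exact Real.sqrt_le_sqrt (by nlinarith [sq_nonneg (x 0)])
  have hu0 : |u x 0| ≤ ‖u x‖ := by
    simpa only [Real.norm_eq_abs] using PiLp.norm_apply_le (u x) 0
  have hu1 : |u x 1| ≤ ‖u x‖ := by
    simpa only [Real.norm_eq_abs] using PiLp.norm_apply_le (u x) 1
  have hr : 0 ≤ cylRadius x := cylRadius_nonneg x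
  have hn : 0 ≤ ‖u x‖ := norm_nonneg _
  calc |swirl u x| = |x 0 * u x 1 - x 1 * u x 0| := rfl
    _ ≤ |x 0 * u x 1| + |x 1 * u x 0| := abs_sub _ _
    _ = |x 0| * |u x 1| + |x 1| * |u x 0| := by rw [abs_mul, abs_mul]
    _ ≤ cylRadius x * ‖u x‖ + cylRadius x * ‖u x‖ := by
        gcongr
    _ = 2 * cylRadius x * ‖u x‖ := by ring

/-- **The axis modulus of the swirl strictly below the lifespan.**  For a Kato solution `u` on
`[0, T')` with `ν > 0`, continuous on `(0, T') × EuclideanSpace ℝ (Fin 3)`, and `0 < T < T'`: on every `[t₀, T)`,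
`0 < t₀ < T`, there are `C` and `δ₀ ∈ (0, 1)` with `|swirl (u t) x| ≤ C / |log (cylRadius x)|³`
whenever `cylRadius x ≤ δ₀` — the trivial half of the registered stub `stub_swirlAxisModulus`,
whose content is the complementary case `T = T' = T_max(u₀)`. -/
theorem swirlAxisModulus_of_lt :
    ∀ (ν T T' : ℝ) (u₀ : EuclideanSpace ℝ (Fin 3) → EuclideanSpace ℝ (Fin 3))
      (u : ℝ → EuclideanSpace ℝ (Fin 3) → EuclideanSpace ℝ (Fin 3)),
      0 < ν → T < T' → IsKatoSolutionOn T' ν u₀ u →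
      ContinuousOn (uncurry u) (Ioo 0 T' ×ˢ univ) →
      ∀ t₀ ∈ Ioo 0 T, ∃ C δ₀ : ℝ, 0 < δ₀ ∧ δ₀ < 1 ∧
        ∀ t ∈ Ico t₀ T, ∀ x : EuclideanSpace ℝ (Fin 3), cylRadius x ≤ δ₀ →
          |swirl (u t) x| ≤ C / |Real.log (cylRadius x)| ^ 3 := by
  intro ν T T' u₀ u hν hTT' hu hcont t₀ ht₀
  -- an essential bound on `(t₀/2, T) × EuclideanSpace ℝ (Fin 3)`, upgraded to an everywhere bound by continuity
  have ha : 0 < t₀ / 2 := by linarith [ht₀.1]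
  obtain ⟨M, hM⟩ := hu.exists_ae_norm_le_of_pos hν ha hTT'
  have hopen : IsOpen (Ioo (t₀ / 2) T ×ˢ (univ : Set (EuclideanSpace ℝ (Fin 3)))) := isOpen_Ioo.prod isOpen_univ
  have hsub : Ioo (t₀ / 2) T ×ˢ (univ : Set (EuclideanSpace ℝ (Fin 3))) ⊆ Ioo 0 T' ×ˢ univ :=
    prod_mono (fun t ht => ⟨ha.trans ht.1, ht.2.trans hTT'⟩) Subset.rfl
  have hbd : ∀ z ∈ Ioo (t₀ / 2) T ×ˢ (univ : Set (EuclideanSpace ℝ (Fin 3))), ‖uncurry u z‖ ≤ M :=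
    SereginSverak2009.forall_le_of_ae_le_of_continuousOn hopen (hcont.mono hsub).norm continuousOn_const hM
  have hM0 : 0 ≤ M := by
    have := hbd (t₀, 0) ⟨⟨by linarith [ht₀.1], ht₀.2⟩, mem_univ _⟩
    exact (norm_nonneg _).trans this
  refine ⟨12 * M, Real.exp (-1), Real.exp_pos _, by
    rw [← Real.exp_zero]; exact Real.exp_lt_exp.2 (by norm_num), ?_⟩
  intro t ht x hx
  rcases (cylRadius_nonneg x).eq_or_lt with hr0 | hrpos
  · -- on the axis both sides vanish (`log 0 = 0`, `C / 0 = 0`)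
    rw [swirl_eq_zero_of_cylRadius_eq_zero (u t) hr0.symm, ← hr0]
    simp
  · have hr1 : cylRadius x < 1 := lt_of_le_of_lt hx (by
      rw [← Real.exp_zero]; exact Real.exp_lt_exp.2 (by norm_num))
    have hlogpos : 0 < |Real.log (cylRadius x)| :=
      abs_pos.2 (Real.log_neg hrpos hr1).ne
    have hpow : 0 < |Real.log (cylRadius x)| ^ 3 := pow_pos hlogpos 3
    have hux : ‖u t x‖ ≤ M := hbd (t, x) ⟨⟨by linarith [ht.1, ht₀.1], ht.2⟩, mem_univ _⟩
    have hkey := mul_abs_log_pow_three_le hrpos hr1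
    rw [le_div_iff₀ hpow]
    calc |swirl (u t) x| * |Real.log (cylRadius x)| ^ 3
        ≤ (2 * cylRadius x * ‖u t x‖) * |Real.log (cylRadius x)| ^ 3 := by
          gcongr
          exact abs_swirl_le_two_mul_cylRadius_mul_norm (u t) x
      _ = 2 * ‖u t x‖ * (cylRadius x * |Real.log (cylRadius x)| ^ 3) := by ring
      _ ≤ 2 * M * 6 := by gcongr
      _ = 12 * M := by ring

end Summit.NavierStokesRegularity.NavierStokesRegularity.Theorems.AxisymmetricKatoGlobal.Registered

end
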